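import Literature.MathematicalPhysics.QuantumLattice.ProjectedEntangledPairStatesGroundStateProofs
import HarnessLib

/-!
# `G`-injective PEPS — proofs, part I: the leg representation, the `G`-injective left inverse, gauge invariance

Sibling proof file of `Literature/MathematicalPhysics/QuantumLattice/ProjectedEntangledPairStates.lean`,
building on `ProjectedEntangledPairStatesGroundStateProofs.lean` (the injective case, whose
virtual-level set-up — leg coordinates `g : Fin 2 → Fin 2 → Fin D` (axis, side), `𝒫^{⊗R}`,
`T^{⊗R}`, block slices — is reused verbatim). Theorems only: no statement or definition is changed
and no definition is introduced (the leg representation `ρ(U)` is always written out as the product of its four leg factors). This is the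
first instalment of the proof of the named fact `pepsParent_groundSpace_of_GInjective`
(Schuch–Cirac–Pérez-García (2010), Thm. 5.7: the ground space of the parent Hamiltonian of a
`G`-injective PEPS is spanned by the `(g,h)`-closed PEPS, `gh = hg`). It provides the single-site
and virtual-level generalities of the `G`-injective setting:

* `ρ(U)(g, g') = Ū(l,l') Ū(u,u') U(r,r') U(d,d')`, the action of `U` on the four legs of a site
  (`Ū` on the incoming legs, `U` on the outgoing ones) — the matrix of `boundaryAct 1 1 U`
  (`boundaryAct_one_one_eq_sum_legs`); it is multiplicative (`sum_legRep_mul_legRep`,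
  `sum_legRep_mul_legRep_hom`) and `ρ(1) = δ` (`legRep_one`);
* `𝒫(A) ∘ ρ(U_k) = 𝒫(A)` for a `G`-invariant tensor (Def. 5.1 (i); `sum_A_mul_legRep_of_invariant`,
  the transpose of `ρ(U)` being `legAct Uᴴ`, cf. `pepsRect_one_one_boundaryAct`);
* **the `G`-injective left inverse** (Def. 5.1 (ii) with Lemma 4.3): from `IsGInjectivePEPS U 1 1 A`
  a tensor `t` with `Σ_s t(g,s) A^s_{g'} = Π_𝒰(g,g')`, `Π_𝒰 = |G|⁻¹ Σ_k ρ(U_k)` the averaging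
  projector onto the `U_k`-invariant boundary tensors (`exists_leg_leftInverse_G`);
* at the virtual level of a region `R`: `T^{⊗R} 𝒫^{⊗R} = ⊗_x π` for any single-site relation
  `T 𝒫 = π` (`virtual_leftInverse_gen`), `𝒫^{⊗R}` absorbs single-site kernels fixed by `𝒫(A)`
  (`virtualP_absorb`), in particular gauge transformations `⊗_x ρ(U_{γ_x})` (`virtualP_gauge`,
  §5.2 eq. (34): "strings of `U_g`'s can be deformed freely due to the `G`-invariance of `A`");
* `ψ = 𝒫^{⊗Λ} T^{⊗Λ} ψ` for a vector with block-state slices: the single-site operator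
  `π = 𝒫(A) T` satisfies `π 𝒫(A) = 𝒫(A)` (`sum_pi_mul_A_of_leftInverse_G`) and hence fixes such a
  vector sitewise (`sum_pi_mul_virtualP_update'`, `sum_pi_update_eq_self_of_slices'` — the
  arguments of the injective file with the single-site identity as hypothesis);
* `T^{⊗Λ} ψ` along a `2 × 2` block for a general relation `T 𝒫 = π`
  (`sum_block_leftInverse_pepsRect_gen`, `virtualT_eq_sum_offBlock_gen`): "apply the left inverse"
  in the proofs of Thm. 5.4 / Lemma 5.2, now producing `Π_𝒰^{⊗4}` of the block tensor.

## References

* N. Schuch, I. Cirac, D. Pérez-García, *PEPS as ground states: degeneracy and topology*,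
  Ann. Phys. **325** (2010) 2153–2192, doi:10.1016/j.aop.2010.05.008, arXiv:1001.3807 (held:
  `paper:arxiv-1001.3807`): Def. 4.2, Lemma 4.3 (the averaging projector
  `σ(X) = |G|⁻¹ Σ_g U_g X U_g†`), Def. 5.1 (`G`-injectivity: (i) invariance, (ii)
  `𝒫(A)⁻¹ 𝒫(A) = Π_𝒰`), Lemma 5.2, §5.2 Thm. 5.4, eq. (34). [SchuchCiracPerezGarcia2010]
-/

noncomputable section

open Matrix Complex Finset
open scoped ComplexOrder

namespace Literature.MathematicalPhysics.QuantumLattice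

open Literature.Probability.LatticeModels

section QLattice

variable {q D : ℕ}

/-! ### The leg representation `ρ(U) = Ū ⊗ Ū ⊗ U ⊗ U` in leg coordinates -/

/-- The single-leg factors of `ρ(U)`: `Ū` on incoming legs (side `0`), `U` on outgoing legs
(side `1`). [folklore] -/
theorem legFactor_apply (U : Matrix (Fin D) (Fin D) ℂ) (s : Fin 2) (a b : Fin D) :
    (![fun a b => star (U a b), fun a b => U a b] : Fin 2 → Fin D → Fin D → ℂ) s a b =
      if s = 0 then star (U a b) else U a b := by
  fin_cases s <;> rfl

/-- A sum over leg configurations of a product over the four legs is the product of the four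
single-leg sums (`Fintype.prod_sum` twice). [folklore] -/
theorem sum_legs_prod_prod (f : Fin 2 → Fin 2 → Fin D → ℂ) :
    ∑ g : Fin 2 → Fin 2 → Fin D, ∏ i, ∏ s, f i s (g i s) = ∏ i, ∏ s, ∑ c, f i s c := by
  symm
  simp only [Fintype.prod_sum]

/-- `ρ(1) = 1`: the identity acts trivially on the legs. [folklore] -/
theorem legRep_one (g g' : Fin 2 → Fin 2 → Fin D) :
    (fun (g g' : Fin 2 → Fin 2 → Fin D) => ∏ i : Fin 2, ∏ s : Fin 2, (![fun a b => star (((1 : Matrix (Fin D) (Fin D) ℂ)) a b), fun a b => ((1 : Matrix (Fin D) (Fin D) ℂ)) a b] : Fin 2 → Fin D → Fin D → ℂ) s (g i s) (g' i s)) g g' = if g = g' then 1 else 0 := by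
  have : ∀ (i s : Fin 2), (![fun a b => star ((1 : Matrix (Fin D) (Fin D) ℂ) a b),
      fun a b => (1 : Matrix (Fin D) (Fin D) ℂ) a b] : Fin 2 → Fin D → Fin D → ℂ) s
      (g i s) (g' i s) = if g i s = g' i s then 1 else 0 := by
    intro i s
    fin_cases s <;> simp [Matrix.one_apply, apply_ite star]
  simp only [this, prod_ite_apply_eq]

/-- The single-leg factors are multiplicative: `Ū V̄ = (UV)‾` and `U V = UV`. [folklore] -/
theorem legFactor_mul (U V : Matrix (Fin D) (Fin D) ℂ) (s : Fin 2) (a b : Fin D) :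
    (![fun a b => star ((U * V) a b), fun a b => (U * V) a b] : Fin 2 → Fin D → Fin D → ℂ) s a b =
      ∑ c, (![fun a b => star (U a b), fun a b => U a b] : Fin 2 → Fin D → Fin D → ℂ) s a c *
        (![fun a b => star (V a b), fun a b => V a b] : Fin 2 → Fin D → Fin D → ℂ) s c b := by
  fin_cases s
  · simp [Matrix.mul_apply, star_sum, star_mul']
  · simp [Matrix.mul_apply]

/-- **`ρ` is multiplicative**: `Σ_{g'} ρ(U)(g,g') ρ(V)(g',g'') = ρ(UV)(g,g'')` (leg by leg).
[folklore] -/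
theorem sum_legRep_mul_legRep (U V : Matrix (Fin D) (Fin D) ℂ) (g g'' : Fin 2 → Fin 2 → Fin D) :
    ∑ g' : Fin 2 → Fin 2 → Fin D, (fun (g g' : Fin 2 → Fin 2 → Fin D) => ∏ i : Fin 2, ∏ s : Fin 2, (![fun a b => star ((U) a b), fun a b => (U) a b] : Fin 2 → Fin D → Fin D → ℂ) s (g i s) (g' i s)) g g' * (fun (g g' : Fin 2 → Fin 2 → Fin D) => ∏ i : Fin 2, ∏ s : Fin 2, (![fun a b => star ((V) a b), fun a b => (V) a b] : Fin 2 → Fin D → Fin D → ℂ) s (g i s) (g' i s)) g' g'' = (fun (g g' : Fin 2 → Fin 2 → Fin D) => ∏ i : Fin 2, ∏ s : Fin 2, (![fun a b => star ((U * V) a b), fun a b => (U * V) a b] : Fin 2 → Fin D → Fin D → ℂ) s (g i s) (g' i s)) g g'' := by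
  simp only [← Finset.prod_mul_distrib]
  rw [sum_legs_prod_prod (fun i s c =>
    (![fun a b => star (U a b), fun a b => U a b] : Fin 2 → Fin D → Fin D → ℂ) s (g i s) c *
      (![fun a b => star (V a b), fun a b => V a b] : Fin 2 → Fin D → Fin D → ℂ) s c (g'' i s))]
  simp only [legFactor_mul]

/-- **`ρ` is a representation of the unitary group on the legs**: `ρ(U_k) ρ(U_h) = ρ(U_{kh})`.
[folklore] -/
theorem sum_legRep_mul_legRep_hom {G : Type*} [Group G] (U : G →* Matrix.unitaryGroup (Fin D) ℂ)
    (k h : G) (g g'' : Fin 2 → Fin 2 → Fin D) :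
    ∑ g' : Fin 2 → Fin 2 → Fin D,
        (fun (g g' : Fin 2 → Fin 2 → Fin D) => ∏ i : Fin 2, ∏ s : Fin 2, (![fun a b => star ((((U k : Matrix.unitaryGroup (Fin D) ℂ) : Matrix (Fin D) (Fin D) ℂ)) a b), fun a b => (((U k : Matrix.unitaryGroup (Fin D) ℂ) : Matrix (Fin D) (Fin D) ℂ)) a b] : Fin 2 → Fin D → Fin D → ℂ) s (g i s) (g' i s)) g g' *
          (fun (g g' : Fin 2 → Fin 2 → Fin D) => ∏ i : Fin 2, ∏ s : Fin 2, (![fun a b => star ((((U h : Matrix.unitaryGroup (Fin D) ℂ) : Matrix (Fin D) (Fin D) ℂ)) a b), fun a b => (((U h : Matrix.unitaryGroup (Fin D) ℂ) : Matrix (Fin D) (Fin D) ℂ)) a b] : Fin 2 → Fin D → Fin D → ℂ) s (g i s) (g' i s)) g' g'' =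
      (fun (g g' : Fin 2 → Fin 2 → Fin D) => ∏ i : Fin 2, ∏ s : Fin 2, (![fun a b => star ((((U (k * h) : Matrix.unitaryGroup (Fin D) ℂ) : Matrix (Fin D) (Fin D) ℂ)) a b), fun a b => (((U (k * h) : Matrix.unitaryGroup (Fin D) ℂ) : Matrix (Fin D) (Fin D) ℂ)) a b] : Fin 2 → Fin D → Fin D → ℂ) s (g i s) (g' i s)) g g'' := by
  rw [sum_legRep_mul_legRep, map_mul]
  rfl

/-- `ρ(U)` written out as the product of its four leg factors. [folklore] -/
theorem legRep_eq_mul (U : Matrix (Fin D) (Fin D) ℂ) (g g' : Fin 2 → Fin 2 → Fin D) :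
    (fun (g g' : Fin 2 → Fin 2 → Fin D) => ∏ i : Fin 2, ∏ s : Fin 2, (![fun a b => star ((U) a b), fun a b => (U) a b] : Fin 2 → Fin D → Fin D → ℂ) s (g i s) (g' i s)) g g' = star (U (g 0 0) (g' 0 0)) * star (U (g 1 0) (g' 1 0)) *
      U (g 0 1) (g' 0 1) * U (g 1 1) (g' 1 1) := by
  simp only [Fin.prod_univ_two, Matrix.cons_val_zero, Matrix.cons_val_one]
  ring

/-- Sums over leg configurations as four single-leg sums, in the order `l, r, u, d`
(`g ↦ ((g 0 0, g 0 1), (g 1 0, g 1 1))`). [folklore] -/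
theorem sum_legs_eq_sum_four {M : Type*} [AddCommMonoid M] (F : (Fin 2 → Fin 2 → Fin D) → M) :
    ∑ g : Fin 2 → Fin 2 → Fin D, F g =
      ∑ a, ∑ c, ∑ b, ∑ d, F ![![a, c], ![b, d]] := by
  let e : (Fin 2 → Fin 2 → Fin D) ≃ (Fin D × Fin D) × (Fin D × Fin D) :=
    (finTwoArrowEquiv (Fin 2 → Fin D)).trans
      ((finTwoArrowEquiv (Fin D)).prodCongr (finTwoArrowEquiv (Fin D)))
  rw [← e.symm.sum_comp]
  simp only [Fintype.sum_prod_type]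
  rfl

/-- **`𝒫(A) ∘ ρ(U) = 𝒫(A)` for a `legAct Uᴴ`-invariant tensor**: in leg coordinates,
`Σ_{g'} A^s_{g'} ρ(U)(g', g) = A^s_g` — the transpose of `ρ(U)` (`boundaryAct`) for the bilinear
pairing is `legAct Uᴴ` (cf. `pepsRect_one_one_boundaryAct`). Schuch–Cirac–Pérez-García (2010)
Def. 5.1 (i). [cite: SchuchCiracPerezGarcia2010, Def. 5.1] -/
theorem sum_A_mul_legRep (U : Matrix (Fin D) (Fin D) ℂ) {A : PEPSTensor q D}
    (hA : ∀ s, legAct Uᴴ (A s) = A s) (s : Fin q) (g : Fin 2 → Fin 2 → Fin D) :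
    ∑ g' : Fin 2 → Fin 2 → Fin D, A s (g' 0 0) (g' 1 0) (g' 0 1) (g' 1 1) * (fun (g g' : Fin 2 → Fin 2 → Fin D) => ∏ i : Fin 2, ∏ s : Fin 2, (![fun a b => star ((U) a b), fun a b => (U) a b] : Fin 2 → Fin D → Fin D → ℂ) s (g i s) (g' i s)) g' g =
      A s (g 0 0) (g 1 0) (g 0 1) (g 1 1) := by
  have h := congrFun (congrFun (congrFun (congrFun (hA s) (g 0 0)) (g 1 0)) (g 0 1)) (g 1 1)
  simp only [legAct, conjTranspose_apply, star_star] at h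
  rw [← h, sum_legs_eq_sum_four]
  simp only [legRep_eq_mul, Matrix.cons_val_zero, Matrix.cons_val_one]
  refine Finset.sum_congr rfl fun a _ => ?_
  rw [Finset.sum_comm]
  refine Finset.sum_congr rfl fun b _ => Finset.sum_congr rfl fun c _ =>
    Finset.sum_congr rfl fun d _ => ?_
  ring

/-- **`𝒫(A) ∘ ρ(U_k) = 𝒫(A)` for a `G`-invariant tensor** (condition (i) of `IsGInjectivePEPS`,
Schuch–Cirac–Pérez-García (2010) Def. 5.1 (i)), for every `k ∈ G`, using `(U_k)ᴴ = U_{k⁻¹}`.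
[cite: SchuchCiracPerezGarcia2010, Def. 5.1] -/
theorem sum_A_mul_legRep_of_invariant {G : Type*} [Group G]
    (U : G →* Matrix.unitaryGroup (Fin D) ℂ) {A : PEPSTensor q D}
    (hA : ∀ (k : G) (s : Fin q), legAct (U k : Matrix.unitaryGroup (Fin D) ℂ) (A s) = A s)
    (k : G) (s : Fin q) (g : Fin 2 → Fin 2 → Fin D) :
    ∑ g' : Fin 2 → Fin 2 → Fin D, A s (g' 0 0) (g' 1 0) (g' 0 1) (g' 1 1) *
        (fun (g g' : Fin 2 → Fin 2 → Fin D) => ∏ i : Fin 2, ∏ s : Fin 2, (![fun a b => star ((((U k : Matrix.unitaryGroup (Fin D) ℂ) : Matrix (Fin D) (Fin D) ℂ)) a b), fun a b => (((U k : Matrix.unitaryGroup (Fin D) ℂ) : Matrix (Fin D) (Fin D) ℂ)) a b] : Fin 2 → Fin D → Fin D → ℂ) s (g i s) (g' i s)) g' g =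
      A s (g 0 0) (g 1 0) (g 0 1) (g 1 1) := by
  refine sum_A_mul_legRep _ (fun s => ?_) s g
  have hinv : ((U k : Matrix.unitaryGroup (Fin D) ℂ) : Matrix (Fin D) (Fin D) ℂ)ᴴ =
      ((U k⁻¹ : Matrix.unitaryGroup (Fin D) ℂ) : Matrix (Fin D) (Fin D) ℂ) := by
    rw [map_inv, ← Matrix.star_eq_conjTranspose]
    rfl
  rw [hinv]
  exact hA k⁻¹ s

/-- **The boundary action in leg coordinates is `ρ(U)`**: for the boundary tensor
`X(l,u,r,d) = Y(![![l 0, r 0], ![u 0, d 0]])` of a single site,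
`boundaryAct 1 1 U X (l,u,r,d) = Σ_{g'} ρ(U)(ĝ, g') Y(g')` with `ĝ = ![![l 0, r 0], ![u 0, d 0]]`.
[cite: SchuchCiracPerezGarcia2010, Def. 5.1] -/
theorem boundaryAct_one_one_eq_sum_legs (U : Matrix (Fin D) (Fin D) ℂ)
    (Y : (Fin 2 → Fin 2 → Fin D) → ℂ) (l u r d : Fin 1 → Fin D) :
    boundaryAct 1 1 U (fun l u r d => Y ![![l 0, r 0], ![u 0, d 0]]) l u r d =
      ∑ g' : Fin 2 → Fin 2 → Fin D, (fun (g g' : Fin 2 → Fin 2 → Fin D) => ∏ i : Fin 2, ∏ s : Fin 2, (![fun a b => star ((U) a b), fun a b => (U) a b] : Fin 2 → Fin D → Fin D → ℂ) s (g i s) (g' i s)) ![![l 0, r 0], ![u 0, d 0]] g' * Y g' := by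
  simp only [boundaryAct, Fin.prod_univ_one, sum_fin_one_fun]
  rw [sum_legs_eq_sum_four]
  simp only [legRep_eq_mul, Matrix.cons_val_zero, Matrix.cons_val_one]
  refine Finset.sum_congr rfl fun a _ => ?_
  rw [Finset.sum_comm]

/-! ### The `G`-injective left inverse: `T 𝒫(A) = Π_𝒰` (Schuch–Cirac–Pérez-García Def. 5.1 (ii)) -/

/-- **The single-site left inverse of a `G`-injective tensor.** If `A` is `G`-injective for the
unitary representation `U` of the finite group `G` (Schuch–Cirac–Pérez-García (2010) Def. 5.1:
(i) `A` is `U_k`-invariant on the virtual level, (ii) `𝒫(A)` has a left inverse on the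
`U_k`-invariant subspace, `𝒫(A)⁻¹ 𝒫(A) = Π_𝒰`), then in leg coordinates there is `t` with
`Σ_s t(g, s) A^s_{g'} = Π_𝒰(g, g')`, where `Π_𝒰 = |G|⁻¹ Σ_k ρ(U_k)` is the averaging projector onto
the invariant boundary tensors (Lemma 4.3). Construction: `𝒫(A) ∘ Π_𝒰 = 𝒫(A)` by (i)
(`sum_A_mul_legRep_of_invariant`), `𝒫(A)` is injective on `range Π_𝒰` by (ii), so a left inverse
of that restriction (`LinearMap.exists_leftInverse_of_injective`) composed with the inclusion does
it. [cite: SchuchCiracPerezGarcia2010, Def. 5.1 and Lemma 4.3] -/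
theorem exists_leg_leftInverse_G {G : Type*} [Group G] [Fintype G]
    (U : G →* Matrix.unitaryGroup (Fin D) ℂ) {A : PEPSTensor q D} (hG : IsGInjectivePEPS U 1 1 A) :
    ∃ t : (Fin 2 → Fin 2 → Fin D) → Fin q → ℂ, ∀ g g' : Fin 2 → Fin 2 → Fin D,
      ∑ s, t g s * A s (g' 0 0) (g' 1 0) (g' 0 1) (g' 1 1) =
        (Fintype.card G : ℂ)⁻¹ *
          ∑ k : G, (fun (g g' : Fin 2 → Fin 2 → Fin D) => ∏ i : Fin 2, ∏ s : Fin 2, (![fun a b => star ((((U k : Matrix.unitaryGroup (Fin D) ℂ) : Matrix (Fin D) (Fin D) ℂ)) a b), fun a b => (((U k : Matrix.unitaryGroup (Fin D) ℂ) : Matrix (Fin D) (Fin D) ℂ)) a b] : Fin 2 → Fin D → Fin D → ℂ) s (g i s) (g' i s)) g g' := by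
  classical
  obtain ⟨hA, hinjA⟩ := hG
  have hcard : (Fintype.card G : ℂ) ≠ 0 := Nat.cast_ne_zero.2 Fintype.card_ne_zero
  -- the single-site map `𝒫(A)` and the averaging projector `Π_𝒰` as linear maps
  let M : ((Fin 2 → Fin 2 → Fin D) → ℂ) →ₗ[ℂ] (Fin q → ℂ) :=
    { toFun := fun Y s => ∑ g, A s (g 0 0) (g 1 0) (g 0 1) (g 1 1) * Y g
      map_add' := fun Y Y' => by
        funext s
        simp only [Pi.add_apply, mul_add, Finset.sum_add_distrib]
      map_smul' := fun c Y => by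
        funext s
        simp only [Pi.smul_apply, smul_eq_mul, RingHom.id_apply, Finset.mul_sum, mul_left_comm] }
  let Pavg : ((Fin 2 → Fin 2 → Fin D) → ℂ) →ₗ[ℂ] ((Fin 2 → Fin 2 → Fin D) → ℂ) :=
    { toFun := fun Y g => (Fintype.card G : ℂ)⁻¹ * ∑ k : G, ∑ g',
        (fun (g g' : Fin 2 → Fin 2 → Fin D) => ∏ i : Fin 2, ∏ s : Fin 2, (![fun a b => star ((((U k : Matrix.unitaryGroup (Fin D) ℂ) : Matrix (Fin D) (Fin D) ℂ)) a b), fun a b => (((U k : Matrix.unitaryGroup (Fin D) ℂ) : Matrix (Fin D) (Fin D) ℂ)) a b] : Fin 2 → Fin D → Fin D → ℂ) s (g i s) (g' i s)) g g' * Y g'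
      map_add' := fun Y Y' => by
        funext g
        simp only [Pi.add_apply, mul_add, Finset.sum_add_distrib]
      map_smul' := fun c Y => by
        funext g
        simp only [Pi.smul_apply, smul_eq_mul, RingHom.id_apply, Finset.mul_sum]
        refine Finset.sum_congr rfl fun k _ => Finset.sum_congr rfl fun g' _ => ?_
        ring }
  have hM : ∀ Y s, M Y s = ∑ g, A s (g 0 0) (g 1 0) (g 0 1) (g 1 1) * Y g := fun Y s => rfl
  have hPdef : ∀ Y g, Pavg Y g = (Fintype.card G : ℂ)⁻¹ * ∑ k : G, ∑ g',
      (fun (g g' : Fin 2 → Fin 2 → Fin D) => ∏ i : Fin 2, ∏ s : Fin 2, (![fun a b => star ((((U k : Matrix.unitaryGroup (Fin D) ℂ) : Matrix (Fin D) (Fin D) ℂ)) a b), fun a b => (((U k : Matrix.unitaryGroup (Fin D) ℂ) : Matrix (Fin D) (Fin D) ℂ)) a b] : Fin 2 → Fin D → Fin D → ℂ) s (g i s) (g' i s)) g g' * Y g' :=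
    fun Y g => rfl
  -- (i) ⇒ `𝒫 ∘ Π_𝒰 = 𝒫`
  have hMP : ∀ Y, M (Pavg Y) = M Y := by
    intro Y
    funext s
    rw [hM, hM]
    simp only [hPdef, Finset.mul_sum]
    calc ∑ g, ∑ k, ∑ g', A s (g 0 0) (g 1 0) (g 0 1) (g 1 1) * ((Fintype.card G : ℂ)⁻¹ *
          ((fun (g g' : Fin 2 → Fin 2 → Fin D) => ∏ i : Fin 2, ∏ s : Fin 2, (![fun a b => star ((((U k : Matrix.unitaryGroup (Fin D) ℂ) : Matrix (Fin D) (Fin D) ℂ)) a b), fun a b => (((U k : Matrix.unitaryGroup (Fin D) ℂ) : Matrix (Fin D) (Fin D) ℂ)) a b] : Fin 2 → Fin D → Fin D → ℂ) s (g i s) (g' i s)) g g' * Y g'))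
        = ∑ k, (Fintype.card G : ℂ)⁻¹ * ∑ g', (∑ g, A s (g 0 0) (g 1 0) (g 0 1) (g 1 1) *
            (fun (g g' : Fin 2 → Fin 2 → Fin D) => ∏ i : Fin 2, ∏ s : Fin 2, (![fun a b => star ((((U k : Matrix.unitaryGroup (Fin D) ℂ) : Matrix (Fin D) (Fin D) ℂ)) a b), fun a b => (((U k : Matrix.unitaryGroup (Fin D) ℂ) : Matrix (Fin D) (Fin D) ℂ)) a b] : Fin 2 → Fin D → Fin D → ℂ) s (g i s) (g' i s)) g g') * Y g' := by
          rw [Finset.sum_comm]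
          refine Finset.sum_congr rfl fun k _ => ?_
          rw [Finset.sum_comm, Finset.mul_sum]
          refine Finset.sum_congr rfl fun g' _ => ?_
          rw [Finset.sum_mul, Finset.mul_sum]
          refine Finset.sum_congr rfl fun g _ => ?_
          ring
      _ = ∑ k : G, (Fintype.card G : ℂ)⁻¹ * ∑ g', A s (g' 0 0) (g' 1 0) (g' 0 1) (g' 1 1) * Y g' := by
          simp only [sum_A_mul_legRep_of_invariant U hA]
      _ = ∑ g, A s (g 0 0) (g 1 0) (g 0 1) (g 1 1) * Y g := by
          rw [Finset.sum_const, Finset.card_univ, nsmul_eq_mul, ← mul_assoc,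
            mul_inv_cancel₀ hcard, one_mul]
  -- `ρ(U_k) ∘ Π_𝒰 = Π_𝒰`: the range of `Π_𝒰` consists of invariant tensors
  have hρP : ∀ (k : G) (Y : (Fin 2 → Fin 2 → Fin D) → ℂ) (g : Fin 2 → Fin 2 → Fin D),
      ∑ g', (fun (g g' : Fin 2 → Fin 2 → Fin D) => ∏ i : Fin 2, ∏ s : Fin 2, (![fun a b => star ((((U k : Matrix.unitaryGroup (Fin D) ℂ) : Matrix (Fin D) (Fin D) ℂ)) a b), fun a b => (((U k : Matrix.unitaryGroup (Fin D) ℂ) : Matrix (Fin D) (Fin D) ℂ)) a b] : Fin 2 → Fin D → Fin D → ℂ) s (g i s) (g' i s)) g g' * Pavg Y g' =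
        Pavg Y g := by
    intro k Y g
    simp only [hPdef, Finset.mul_sum]
    calc ∑ g', ∑ h, ∑ g'', (fun (g g' : Fin 2 → Fin 2 → Fin D) => ∏ i : Fin 2, ∏ s : Fin 2, (![fun a b => star ((((U k : Matrix.unitaryGroup (Fin D) ℂ) : Matrix (Fin D) (Fin D) ℂ)) a b), fun a b => (((U k : Matrix.unitaryGroup (Fin D) ℂ) : Matrix (Fin D) (Fin D) ℂ)) a b] : Fin 2 → Fin D → Fin D → ℂ) s (g i s) (g' i s)) g g' *
          ((Fintype.card G : ℂ)⁻¹ *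
            ((fun (g g' : Fin 2 → Fin 2 → Fin D) => ∏ i : Fin 2, ∏ s : Fin 2, (![fun a b => star ((((U h : Matrix.unitaryGroup (Fin D) ℂ) : Matrix (Fin D) (Fin D) ℂ)) a b), fun a b => (((U h : Matrix.unitaryGroup (Fin D) ℂ) : Matrix (Fin D) (Fin D) ℂ)) a b] : Fin 2 → Fin D → Fin D → ℂ) s (g i s) (g' i s)) g' g'' * Y g''))
        = ∑ h, ∑ g'', (Fintype.card G : ℂ)⁻¹ * ((∑ g',
            (fun (g g' : Fin 2 → Fin 2 → Fin D) => ∏ i : Fin 2, ∏ s : Fin 2, (![fun a b => star ((((U k : Matrix.unitaryGroup (Fin D) ℂ) : Matrix (Fin D) (Fin D) ℂ)) a b), fun a b => (((U k : Matrix.unitaryGroup (Fin D) ℂ) : Matrix (Fin D) (Fin D) ℂ)) a b] : Fin 2 → Fin D → Fin D → ℂ) s (g i s) (g' i s)) g g' *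
            (fun (g g' : Fin 2 → Fin 2 → Fin D) => ∏ i : Fin 2, ∏ s : Fin 2, (![fun a b => star ((((U h : Matrix.unitaryGroup (Fin D) ℂ) : Matrix (Fin D) (Fin D) ℂ)) a b), fun a b => (((U h : Matrix.unitaryGroup (Fin D) ℂ) : Matrix (Fin D) (Fin D) ℂ)) a b] : Fin 2 → Fin D → Fin D → ℂ) s (g i s) (g' i s)) g' g'') * Y g'') := by
          rw [Finset.sum_comm]
          refine Finset.sum_congr rfl fun h _ => ?_
          rw [Finset.sum_comm]
          refine Finset.sum_congr rfl fun g'' _ => ?_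
          rw [Finset.sum_mul, Finset.mul_sum]
          refine Finset.sum_congr rfl fun g' _ => ?_
          ring
      _ = ∑ h, ∑ g'', (Fintype.card G : ℂ)⁻¹ *
            ((fun (g g' : Fin 2 → Fin 2 → Fin D) => ∏ i : Fin 2, ∏ s : Fin 2, (![fun a b => star ((((U (k * h) : Matrix.unitaryGroup (Fin D) ℂ) : Matrix (Fin D) (Fin D) ℂ)) a b), fun a b => (((U (k * h) : Matrix.unitaryGroup (Fin D) ℂ) : Matrix (Fin D) (Fin D) ℂ)) a b] : Fin 2 → Fin D → Fin D → ℂ) s (g i s) (g' i s)) g g'' * Y g'') := by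
          simp only [sum_legRep_mul_legRep_hom]
      _ = ∑ h, ∑ g'', (Fintype.card G : ℂ)⁻¹ *
            ((fun (g g' : Fin 2 → Fin 2 → Fin D) => ∏ i : Fin 2, ∏ s : Fin 2, (![fun a b => star ((((U h : Matrix.unitaryGroup (Fin D) ℂ) : Matrix (Fin D) (Fin D) ℂ)) a b), fun a b => (((U h : Matrix.unitaryGroup (Fin D) ℂ) : Matrix (Fin D) (Fin D) ℂ)) a b] : Fin 2 → Fin D → Fin D → ℂ) s (g i s) (g' i s)) g g'' * Y g'') :=
          Fintype.sum_equiv (Equiv.mulLeft k) _ _ fun h => rfl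
  -- (ii) ⇒ `𝒫` is injective on `range Π_𝒰`
  have hinj : ∀ Y, M (Pavg Y) = 0 → Pavg Y = 0 := by
    intro Y hY
    have hX := hinjA (fun l u r d => Pavg Y ![![l 0, r 0], ![u 0, d 0]]) (fun k => ?_) ?_
    · funext g
      have h1 := congrFun (congrFun (congrFun (congrFun hX (fun _ => g 0 0)) (fun _ => g 1 0))
        (fun _ => g 0 1)) (fun _ => g 1 1)
      simp only [vec2_vec2_eta] at h1
      exact h1
    · funext l u r d
      rw [boundaryAct_one_one_eq_sum_legs]
      exact hρP k Y _
    · funext σ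
      rw [pepsRect_one_one_eq_sum_legs]
      exact congrFun hY (σ (0, 0))
  -- the left inverse on `range Π_𝒰`, extended by the inclusion
  set P : Submodule ℂ ((Fin 2 → Fin 2 → Fin D) → ℂ) := LinearMap.range Pavg with hP
  have hker : LinearMap.ker (M.comp P.subtype) = ⊥ := by
    rw [LinearMap.ker_eq_bot']
    rintro ⟨Y, hY⟩ h0
    obtain ⟨Y₀, rfl⟩ := LinearMap.mem_range.1 hY
    exact Subtype.ext (hinj Y₀ h0)
  obtain ⟨Tl, hTl⟩ := (M.comp P.subtype).exists_leftInverse_of_injective hker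
  set T : (Fin q → ℂ) →ₗ[ℂ] ((Fin 2 → Fin 2 → Fin D) → ℂ) := P.subtype.comp Tl with hT_def
  have hT : ∀ Y, T (M Y) = Pavg Y := by
    intro Y
    have hmem : Pavg Y ∈ P := LinearMap.mem_range.2 ⟨Y, rfl⟩
    have h1 : M Y = (M.comp P.subtype) ⟨Pavg Y, hmem⟩ := by
      rw [LinearMap.comp_apply, Submodule.subtype_apply, hMP]
    rw [h1, hT_def, LinearMap.comp_apply, ← LinearMap.comp_apply (f := Tl), hTl]
    rfl
  refine ⟨fun g s => T (Pi.single s 1) g, fun g g' => ?_⟩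
  have hMs : M (Pi.single g' 1) =
      ∑ s, A s (g' 0 0) (g' 1 0) (g' 0 1) (g' 1 1) • (Pi.single s 1 : Fin q → ℂ) := by
    funext s
    simp only [hM, Pi.single_apply, mul_ite, mul_one, mul_zero, Finset.sum_ite_eq',
      Finset.mem_univ, if_true, Finset.sum_apply, Pi.smul_apply, smul_eq_mul]
    rw [Finset.sum_eq_single s]
    · simp
    · intro s' _ hs'
      simp [Ne.symm hs']
    · simp
  have h := congrFun (hT (Pi.single g' 1)) g
  rw [hMs, map_sum] at h
  simp only [map_smul, Finset.sum_apply, Pi.smul_apply, smul_eq_mul] at h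
  rw [hPdef] at h
  simp only [Pi.single_apply, mul_ite, mul_one, mul_zero, Finset.sum_ite_eq', Finset.mem_univ,
    if_true] at h
  rw [← h]
  exact Finset.sum_congr rfl fun s _ => mul_comm _ _

/-! ### `T^{⊗R} 𝒫^{⊗R} = Π^{⊗R}` and `𝒫^{⊗R}` absorbs the gauge action -/

/-- **`T^{⊗R} ∘ 𝒫^{⊗R} = ⊗_x π`** for a single-site relation `Σ_s t(g,s) A^s_{g'} = π(g, g')`:
applying `𝒫(A)` at every site of a finite region to a virtual tensor and then `t` at every site
gives the tensor power of `π` applied to it (for an injective tensor `π = δ`, for a `G`-injective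
one `π = Π_𝒰`, Schuch–Cirac–Pérez-García (2010) Def. 5.1 (ii) and Lemma 5.2).
[cite: SchuchCiracPerezGarcia2010, Def. 5.1] -/
theorem virtual_leftInverse_gen {R : Type*} [Fintype R] [DecidableEq R] (A : PEPSTensor q D)
    (t : (Fin 2 → Fin 2 → Fin D) → Fin q → ℂ) (π : (Fin 2 → Fin 2 → Fin D) → (Fin 2 → Fin 2 → Fin D) → ℂ)
    (ht : ∀ g g' : Fin 2 → Fin 2 → Fin D,
      ∑ s, t g s * A s (g' 0 0) (g' 1 0) (g' 0 1) (g' 1 1) = π g g')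
    (Φ : (R → Fin 2 → Fin 2 → Fin D) → ℂ) (G : R → Fin 2 → Fin 2 → Fin D) :
    ∑ σ : R → Fin q, (∏ x, t (G x) (σ x)) *
      ∑ G' : R → Fin 2 → Fin 2 → Fin D,
        (∏ x, A (σ x) (G' x 0 0) (G' x 1 0) (G' x 0 1) (G' x 1 1)) * Φ G' =
      ∑ G' : R → Fin 2 → Fin 2 → Fin D, (∏ x, π (G x) (G' x)) * Φ G' := by
  calc ∑ σ : R → Fin q, (∏ x, t (G x) (σ x)) *
        ∑ G' : R → Fin 2 → Fin 2 → Fin D,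
          (∏ x, A (σ x) (G' x 0 0) (G' x 1 0) (G' x 0 1) (G' x 1 1)) * Φ G'
      = ∑ G' : R → Fin 2 → Fin 2 → Fin D, (∑ σ : R → Fin q,
          ∏ x, t (G x) (σ x) * A (σ x) (G' x 0 0) (G' x 1 0) (G' x 0 1) (G' x 1 1)) * Φ G' := by
        simp only [Finset.mul_sum, Finset.sum_mul, Finset.prod_mul_distrib, mul_assoc]
        exact Finset.sum_comm
    _ = ∑ G' : R → Fin 2 → Fin 2 → Fin D, (∏ x, π (G x) (G' x)) * Φ G' := by
        refine Finset.sum_congr rfl fun G' _ => ?_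
        rw [← Fintype.prod_sum fun x s => t (G x) s * A s (G' x 0 0) (G' x 1 0) (G' x 0 1) (G' x 1 1)]
        simp only [ht]

/-- **`𝒫^{⊗R}` absorbs single-site kernels fixed by `𝒫(A)`**: if `Σ_{g'} A^s_{g'} κ_x(g', g) = A^s_g`
at every site `x` (e.g. `κ_x = ρ(U_{γ_x})` for a `G`-invariant tensor, a gauge transformation; or
`κ_x = Π_𝒰`), then `𝒫^{⊗R} ((⊗_x κ_x) Φ) = 𝒫^{⊗R} Φ`. Schuch–Cirac–Pérez-García (2010) §5.2
("strings of `U_g`'s can be deformed freely due to the `G`-invariance of `A`").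
[cite: SchuchCiracPerezGarcia2010, Def. 5.1] -/
theorem virtualP_absorb {R : Type*} [Fintype R] [DecidableEq R] (A : PEPSTensor q D)
    (κ : R → (Fin 2 → Fin 2 → Fin D) → (Fin 2 → Fin 2 → Fin D) → ℂ)
    (hκ : ∀ (x : R) (s : Fin q) (g : Fin 2 → Fin 2 → Fin D),
      ∑ g' : Fin 2 → Fin 2 → Fin D, A s (g' 0 0) (g' 1 0) (g' 0 1) (g' 1 1) * κ x g' g =
        A s (g 0 0) (g 1 0) (g 0 1) (g 1 1))
    (Φ : (R → Fin 2 → Fin 2 → Fin D) → ℂ) (σ : R → Fin q) :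
    ∑ G' : R → Fin 2 → Fin 2 → Fin D, (∏ x, A (σ x) (G' x 0 0) (G' x 1 0) (G' x 0 1) (G' x 1 1)) *
        ∑ G : R → Fin 2 → Fin 2 → Fin D, (∏ x, κ x (G' x) (G x)) * Φ G =
      ∑ G : R → Fin 2 → Fin 2 → Fin D, (∏ x, A (σ x) (G x 0 0) (G x 1 0) (G x 0 1) (G x 1 1)) * Φ G := by
  calc ∑ G' : R → Fin 2 → Fin 2 → Fin D, (∏ x, A (σ x) (G' x 0 0) (G' x 1 0) (G' x 0 1) (G' x 1 1)) *
        ∑ G : R → Fin 2 → Fin 2 → Fin D, (∏ x, κ x (G' x) (G x)) * Φ G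
      = ∑ G : R → Fin 2 → Fin 2 → Fin D, (∑ G' : R → Fin 2 → Fin 2 → Fin D,
          ∏ x, A (σ x) (G' x 0 0) (G' x 1 0) (G' x 0 1) (G' x 1 1) * κ x (G' x) (G x)) * Φ G := by
        simp only [Finset.mul_sum, Finset.sum_mul, Finset.prod_mul_distrib, mul_assoc]
        exact Finset.sum_comm
    _ = _ := by
        refine Finset.sum_congr rfl fun G _ => ?_
        rw [← Fintype.prod_sum fun x (g' : Fin 2 → Fin 2 → Fin D) =>
          A (σ x) (g' 0 0) (g' 1 0) (g' 0 1) (g' 1 1) * κ x g' (G x)]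
        simp only [hκ]

/-- **`𝒫^{⊗R}` is invariant under gauge transformations** `γ : R → G` acting by `ρ(U_{γ_x})` on
the legs of the site `x`, for a `G`-invariant tensor (`IsGInjectivePEPS` (i)):
`𝒫^{⊗R}((⊗_x ρ(U_{γ_x})) Φ) = 𝒫^{⊗R} Φ`. Schuch–Cirac–Pérez-García (2010) §5.2, eq. (34).
[cite: SchuchCiracPerezGarcia2010, Def. 5.1] -/
theorem virtualP_gauge {R : Type*} [Fintype R] [DecidableEq R] {G : Type*} [Group G]
    (U : G →* Matrix.unitaryGroup (Fin D) ℂ) {A : PEPSTensor q D}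
    (hA : ∀ (k : G) (s : Fin q), legAct (U k : Matrix.unitaryGroup (Fin D) ℂ) (A s) = A s)
    (γ : R → G) (Φ : (R → Fin 2 → Fin 2 → Fin D) → ℂ) (σ : R → Fin q) :
    ∑ G' : R → Fin 2 → Fin 2 → Fin D, (∏ x, A (σ x) (G' x 0 0) (G' x 1 0) (G' x 0 1) (G' x 1 1)) *
        ∑ G₁ : R → Fin 2 → Fin 2 → Fin D,
          (∏ x, (fun (g g' : Fin 2 → Fin 2 → Fin D) => ∏ i : Fin 2, ∏ s : Fin 2, (![fun a b => star ((((U (γ x) : Matrix.unitaryGroup (Fin D) ℂ) : Matrix (Fin D) (Fin D) ℂ)) a b), fun a b => (((U (γ x) : Matrix.unitaryGroup (Fin D) ℂ) : Matrix (Fin D) (Fin D) ℂ)) a b] : Fin 2 → Fin D → Fin D → ℂ) s (g i s) (g' i s)) (G' x) (G₁ x)) *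
            Φ G₁ =
      ∑ G₁ : R → Fin 2 → Fin 2 → Fin D,
        (∏ x, A (σ x) (G₁ x 0 0) (G₁ x 1 0) (G₁ x 0 1) (G₁ x 1 1)) * Φ G₁ :=
  virtualP_absorb A _ (fun x s g => sum_A_mul_legRep_of_invariant U hA (γ x) s g) Φ σ

/-- **`π = 𝒫(A) T` reproduces `𝒫(A)`**: if `Σ_s t(g,s) A^s_{g'} = Π_𝒰(g,g')` (the `G`-injective
left inverse) and `A` is `G`-invariant, then `Σ_{s'} π(s, s') A^{s'}_g = A^s_g` for
`π(s, s') = Σ_{g'} A^s_{g'} t(g', s')`, because `𝒫(A) Π_𝒰 = 𝒫(A)`.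
[cite: SchuchCiracPerezGarcia2010, Def. 5.1] -/
theorem sum_pi_mul_A_of_leftInverse_G {G : Type*} [Group G] [Fintype G]
    (U : G →* Matrix.unitaryGroup (Fin D) ℂ) {A : PEPSTensor q D}
    (hA : ∀ (k : G) (s : Fin q), legAct (U k : Matrix.unitaryGroup (Fin D) ℂ) (A s) = A s)
    (t : (Fin 2 → Fin 2 → Fin D) → Fin q → ℂ)
    (ht : ∀ g g' : Fin 2 → Fin 2 → Fin D,
      ∑ s, t g s * A s (g' 0 0) (g' 1 0) (g' 0 1) (g' 1 1) =
        (Fintype.card G : ℂ)⁻¹ *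
          ∑ k : G, (fun (g g' : Fin 2 → Fin 2 → Fin D) => ∏ i : Fin 2, ∏ s : Fin 2, (![fun a b => star ((((U k : Matrix.unitaryGroup (Fin D) ℂ) : Matrix (Fin D) (Fin D) ℂ)) a b), fun a b => (((U k : Matrix.unitaryGroup (Fin D) ℂ) : Matrix (Fin D) (Fin D) ℂ)) a b] : Fin 2 → Fin D → Fin D → ℂ) s (g i s) (g' i s)) g g')
    (s : Fin q) (g : Fin 2 → Fin 2 → Fin D) :
    ∑ s', (∑ g' : Fin 2 → Fin 2 → Fin D, A s (g' 0 0) (g' 1 0) (g' 0 1) (g' 1 1) * t g' s') *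
        A s' (g 0 0) (g 1 0) (g 0 1) (g 1 1) = A s (g 0 0) (g 1 0) (g 0 1) (g 1 1) := by
  have hcard : (Fintype.card G : ℂ) ≠ 0 := Nat.cast_ne_zero.2 Fintype.card_ne_zero
  calc ∑ s', (∑ g' : Fin 2 → Fin 2 → Fin D, A s (g' 0 0) (g' 1 0) (g' 0 1) (g' 1 1) * t g' s') *
        A s' (g 0 0) (g 1 0) (g 0 1) (g 1 1)
      = ∑ g' : Fin 2 → Fin 2 → Fin D, A s (g' 0 0) (g' 1 0) (g' 0 1) (g' 1 1) *
          ∑ s', t g' s' * A s' (g 0 0) (g 1 0) (g 0 1) (g 1 1) := by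
        simp only [Finset.sum_mul, Finset.mul_sum, mul_assoc]
        exact Finset.sum_comm
    _ = (Fintype.card G : ℂ)⁻¹ * ∑ k : G, ∑ g' : Fin 2 → Fin 2 → Fin D,
          A s (g' 0 0) (g' 1 0) (g' 0 1) (g' 1 1) *
            (fun (g g' : Fin 2 → Fin 2 → Fin D) => ∏ i : Fin 2, ∏ s : Fin 2, (![fun a b => star ((((U k : Matrix.unitaryGroup (Fin D) ℂ) : Matrix (Fin D) (Fin D) ℂ)) a b), fun a b => (((U k : Matrix.unitaryGroup (Fin D) ℂ) : Matrix (Fin D) (Fin D) ℂ)) a b] : Fin 2 → Fin D → Fin D → ℂ) s (g i s) (g' i s)) g' g := by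
        simp only [ht, Finset.mul_sum]
        rw [Finset.sum_comm]
        refine Finset.sum_congr rfl fun k _ => Finset.sum_congr rfl fun g' _ => ?_
        ring
    _ = A s (g 0 0) (g 1 0) (g 0 1) (g 1 1) := by
        simp only [sum_A_mul_legRep_of_invariant U hA]
        rw [Finset.sum_const, Finset.card_univ, nsmul_eq_mul, ← mul_assoc,
          inv_mul_cancel₀ hcard, one_mul]

/-! ### `ψ = 𝒫^{⊗Λ} T^{⊗Λ} ψ` for a zero-energy vector (`π = 𝒫(A) T` fixes `ψ` sitewise) -/

/-- **The single-site operator `π` fixes states in the range of `𝒫^{⊗R}`** whenever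
`Σ_{s'} π(s, s') A^{s'}_g = A^s_g`: applying `π` at one site `p₀` of a region to `𝒫^{⊗R} Φ` gives
back `𝒫^{⊗R} Φ` (the argument of `sum_pi_mul_virtualP_update`, with the single-site identity as
the hypothesis). [folklore] -/
theorem sum_pi_mul_virtualP_update' {R : Type*} [Fintype R] [DecidableEq R] (A : PEPSTensor q D)
    (π : Fin q → Fin q → ℂ)
    (hπ : ∀ (s : Fin q) (g : Fin 2 → Fin 2 → Fin D),
      ∑ s', π s s' * A s' (g 0 0) (g 1 0) (g 0 1) (g 1 1) = A s (g 0 0) (g 1 0) (g 0 1) (g 1 1))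
    (Φ : (R → Fin 2 → Fin 2 → Fin D) → ℂ) (ρ : R → Fin q) (p₀ : R) :
    ∑ s : Fin q, π (ρ p₀) s *
        ∑ G : R → Fin 2 → Fin 2 → Fin D,
          (∏ p, A (Function.update ρ p₀ s p) (G p 0 0) (G p 1 0) (G p 0 1) (G p 1 1)) * Φ G =
      ∑ G : R → Fin 2 → Fin 2 → Fin D, (∏ p, A (ρ p) (G p 0 0) (G p 1 0) (G p 0 1) (G p 1 1)) * Φ G := by
  have hexp : ∀ (s : Fin q) (G : R → Fin 2 → Fin 2 → Fin D),
      (∏ p, A (Function.update ρ p₀ s p) (G p 0 0) (G p 1 0) (G p 0 1) (G p 1 1)) =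
        A s (G p₀ 0 0) (G p₀ 1 0) (G p₀ 0 1) (G p₀ 1 1) *
          ∏ p ∈ Finset.univ.erase p₀, A (ρ p) (G p 0 0) (G p 1 0) (G p 0 1) (G p 1 1) := by
    intro s G
    rw [← Finset.mul_prod_erase _ _ (Finset.mem_univ p₀), Function.update_self]
    congr 1
    exact Finset.prod_congr rfl fun p hp => by rw [Function.update_of_ne (Finset.ne_of_mem_erase hp)]
  simp only [hexp, Finset.mul_sum]
  rw [Finset.sum_comm]
  refine Finset.sum_congr rfl fun G _ => ?_
  simp only [← mul_assoc, ← Finset.sum_mul, hπ]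
  congr 1
  exact Finset.mul_prod_erase Finset.univ
    (fun p => A (ρ p) (G p 0 0) (G p 1 0) (G p 0 1) (G p 1 1)) (Finset.mem_univ p₀)

/-- **A vector with block-state slices is fixed by `π` at every site** (`2 ≤ L`), for any
single-site operator `π` with `Σ_{s'} π(s,s') A^{s'}_g = A^s_g`: the site `y` is the anchor of the
block at `y`, the slice of `ψ` along that block is `ψ_X = 𝒫^{⊗4}(δ_inner X)`, and `π 𝒫 = 𝒫`
sitewise. (The argument of `sum_pi_update_eq_self_of_slices`, Schuch–Cirac–Pérez-García (2010)
Def. 3.1 / Def. 5.1, with the single-site identity as the hypothesis.)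
[cite: SchuchCiracPerezGarcia2010, Def. 5.1] -/
theorem sum_pi_update_eq_self_of_slices' (L : ℕ) [NeZero L] (hL : 2 ≤ L) (A : PEPSTensor q D)
    (π : Fin q → Fin q → ℂ)
    (hπ : ∀ (s : Fin q) (g : Fin 2 → Fin 2 → Fin D),
      ∑ s', π s s' * A s' (g 0 0) (g 1 0) (g 0 1) (g 1 1) = A s (g 0 0) (g 1 0) (g 0 1) (g 1 1))
    (ψ : TensorIndex (TorusSite 2 L) q → ℂ)
    (hψ : ∀ (x : TorusSite 2 L) (σ : TensorIndex (TorusSite 2 L) q), ∃ X : PEPSBoundary D 2 2,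
      ∀ β : torusBlock L 2 2 x → Fin q,
        ψ (Subtype.val.extend β σ) = pepsRect 2 2 A X (fun p => β (torusBlockElem L 2 2 x p)))
    (y : TorusSite 2 L) (σ : TensorIndex (TorusSite 2 L) q) :
    ∑ s : Fin q, π (σ y) s * ψ (Function.update σ y s) = ψ σ := by
  have hy0 : torusBlockSite L 2 2 y (0, 0) = y := torusBlockSite_zero_zero L 1 1 y
  have hy : y ∈ torusBlock L 2 2 y := Finset.mem_image.2 ⟨(0, 0), Finset.mem_univ _, hy0⟩
  have helem : torusBlockElem L 2 2 y (0, 0) = ⟨y, hy⟩ := Subtype.ext hy0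
  have hinj : Function.Injective (torusBlockElem L 2 2 y) :=
    (torusBlockElem_bijective L 2 2 hL hL y).1
  obtain ⟨X, hX⟩ := hψ y σ
  set ρ : Fin 2 × Fin 2 → Fin q := fun p => σ (torusBlockSite L 2 2 y p) with hρ
  have hσ : ψ σ = pepsRect 2 2 A X ρ := by
    conv_lhs => rw [← extend_val_restrict (torusBlock L 2 2 y) σ]
    exact hX _
  have hupd : ∀ s, ψ (Function.update σ y s) = pepsRect 2 2 A X (Function.update ρ (0, 0) s) := by
    intro s
    rw [update_eq_extend_val_update (torusBlock L 2 2 y) σ hy s, hX]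
    congr 1
    rw [← helem]
    exact Function.update_comp_eq_of_injective' (fun z : torusBlock L 2 2 y => σ z) hinj (0, 0) s
  have hρ0 : σ y = ρ (0, 0) := by
    change σ y = σ (torusBlockSite L 2 2 y (0, 0))
    rw [hy0]
  simp only [hupd, hσ, hρ0, pepsRect_two_two_eq_sum_legs]
  have hite : ∀ (P : Prop) [Decidable P] (a b : ℂ),
      (if P then a * b else 0) = a * (if P then b else 0) := by
    intros
    split_ifs <;> simp
  simp only [hite]
  exact sum_pi_mul_virtualP_update' A π hπ _ ρ (0, 0)

/-! ### `T^{⊗Λ} ψ` along a block, for a general single-site relation `T 𝒫 = π` -/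

/-- **`T^{⊗4}` of a block state**, for a single-site relation `Σ_s t(g,s) A^s_{g'} = π(g,g')` (on
the block of the torus anchored at `x`, `2 ≤ L`):
`Σ_β (Π_{y ∈ B} t(G_y, β_y)) ψ_X(β ∘ (p ↦ x + p)) = Σ_{G'} (Π_p π(G_{x+p}, G'_p)) [inner bonds of G'
match] X(outer legs of G')` (`pepsRect_two_two_eq_sum_legs` and `virtual_leftInverse_gen`).
Schuch–Cirac–Pérez-García (2010), proofs of Thm. 5.4 / Lemma 5.2 ("apply the left inverse").
[cite: SchuchCiracPerezGarcia2010, Thm. 5.4] -/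
theorem sum_block_leftInverse_pepsRect_gen (L : ℕ) [NeZero L] (hL : 2 ≤ L) (A : PEPSTensor q D)
    (t : (Fin 2 → Fin 2 → Fin D) → Fin q → ℂ) (π : (Fin 2 → Fin 2 → Fin D) → (Fin 2 → Fin 2 → Fin D) → ℂ)
    (ht : ∀ g g' : Fin 2 → Fin 2 → Fin D,
      ∑ s, t g s * A s (g' 0 0) (g' 1 0) (g' 0 1) (g' 1 1) = π g g')
    (x : TorusSite 2 L) (X : PEPSBoundary D 2 2) (G : TorusSite 2 L → Fin 2 → Fin 2 → Fin D) :
    ∑ β : torusBlock L 2 2 x → Fin q, (∏ y : torusBlock L 2 2 x, t (G y) (β y)) *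
        pepsRect 2 2 A X (fun p => β (torusBlockElem L 2 2 x p)) =
      ∑ G' : Fin 2 × Fin 2 → Fin 2 → Fin 2 → Fin D,
        (∏ p, π (G (torusBlockSite L 2 2 x p)) (G' p)) *
          (if (∀ b : Fin 2, G' (0, b) 0 1 = G' (1, b) 0 0) ∧ (∀ a : Fin 2, G' (a, 0) 1 1 = G' (a, 1) 1 0)
            then X (fun b => G' (0, b) 0 0) (fun a => G' (a, 0) 1 0) (fun b => G' (1, b) 0 1)
              (fun a => G' (a, 1) 1 1) else 0) := by
  have hbij := torusBlockElem_bijective L 2 2 hL hL x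
  have hf : Function.Bijective fun (β : torusBlock L 2 2 x → Fin q) (p : Fin 2 × Fin 2) =>
      β (torusBlockElem L 2 2 x p) := hbij.comp_right
  set g := Equiv.ofBijective _ hf with hg
  rw [← g.symm.sum_comp]
  have h1 : ∀ ρ : Fin 2 × Fin 2 → Fin q,
      (∏ y : torusBlock L 2 2 x, t (G y) (g.symm ρ y)) =
        ∏ p : Fin 2 × Fin 2, t (G (torusBlockSite L 2 2 x p)) (ρ p) := by
    intro ρ
    symm
    refine Fintype.prod_bijective _ hbij _ _ fun p => ?_
    have h := congrFun (g.apply_symm_apply ρ) p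
    simp only [hg, Equiv.ofBijective_apply] at h
    rw [← h]
    rfl
  have h2 : ∀ ρ : Fin 2 × Fin 2 → Fin q,
      (fun p => g.symm ρ (torusBlockElem L 2 2 x p)) = ρ := fun ρ => g.apply_symm_apply ρ
  have hite : ∀ (P : Prop) [Decidable P] (a b : ℂ),
      (if P then a * b else 0) = a * (if P then b else 0) := by
    intros
    split_ifs <;> simp
  have h3 : ∀ ρ : Fin 2 × Fin 2 → Fin q,
      (fun β : torusBlock L 2 2 x → Fin q => (∏ y : torusBlock L 2 2 x, t (G y) (β y)) *
        pepsRect 2 2 A X (fun p => β (torusBlockElem L 2 2 x p))) (g.symm ρ) =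
      (∏ p : Fin 2 × Fin 2, t (G (torusBlockSite L 2 2 x p)) (ρ p)) *
        ∑ G' : Fin 2 × Fin 2 → Fin 2 → Fin 2 → Fin D,
          (∏ p, A (ρ p) (G' p 0 0) (G' p 1 0) (G' p 0 1) (G' p 1 1)) *
            (if (∀ b : Fin 2, G' (0, b) 0 1 = G' (1, b) 0 0) ∧
                (∀ a : Fin 2, G' (a, 0) 1 1 = G' (a, 1) 1 0)
              then X (fun b => G' (0, b) 0 0) (fun a => G' (a, 0) 1 0) (fun b => G' (1, b) 0 1)
                (fun a => G' (a, 1) 1 1) else 0) := by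
    intro ρ
    dsimp only
    rw [h1 ρ, h2 ρ, pepsRect_two_two_eq_sum_legs]
    simp only [hite]
  simp only [h3]
  exact virtual_leftInverse_gen A t π ht _ (fun p => G (torusBlockSite L 2 2 x p))

/-- **`T^{⊗Λ} ψ` along a block**, for a single-site relation `T 𝒫 = π`. If every slice of `ψ`
along the block `B` at `x` is a block state, `ψ(β ⊔ γ) = ψ_{X(γ)}(β ∘ (p ↦ x + p))`, then
`(T^{⊗Λ} ψ)(G) = Σ_γ (Π_{y ∉ B} t(G_y, γ_y)) Σ_{G'} (Π_p π(G_{x+p}, G'_p)) [inner bonds of G' match]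
X(γ)(outer legs of G')`. Schuch–Cirac–Pérez-García (2010), proof of Thm. 5.4.
[cite: SchuchCiracPerezGarcia2010, Thm. 5.4] -/
theorem virtualT_eq_sum_offBlock_gen (L : ℕ) [NeZero L] (hL : 2 ≤ L) (A : PEPSTensor q D)
    (t : (Fin 2 → Fin 2 → Fin D) → Fin q → ℂ) (π : (Fin 2 → Fin 2 → Fin D) → (Fin 2 → Fin 2 → Fin D) → ℂ)
    (ht : ∀ g g' : Fin 2 → Fin 2 → Fin D,
      ∑ s, t g s * A s (g' 0 0) (g' 1 0) (g' 0 1) (g' 1 1) = π g g')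
    (x : TorusSite 2 L) (ψ : TensorIndex (TorusSite 2 L) q → ℂ)
    (Xf : ({y // y ∉ torusBlock L 2 2 x} → Fin q) → PEPSBoundary D 2 2)
    (hXf : ∀ (γ : {y // y ∉ torusBlock L 2 2 x} → Fin q) (β : torusBlock L 2 2 x → Fin q),
      ψ (fun y => if h : y ∈ torusBlock L 2 2 x then β ⟨y, h⟩ else γ ⟨y, h⟩) =
        pepsRect 2 2 A (Xf γ) (fun p => β (torusBlockElem L 2 2 x p)))
    (G : TorusSite 2 L → Fin 2 → Fin 2 → Fin D) :
    ∑ σ : TensorIndex (TorusSite 2 L) q, (∏ y, t (G y) (σ y)) * ψ σ =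
      ∑ γ : {y // y ∉ torusBlock L 2 2 x} → Fin q,
        (∏ y : {y // y ∉ torusBlock L 2 2 x}, t (G y) (γ y)) *
        ∑ G' : Fin 2 × Fin 2 → Fin 2 → Fin 2 → Fin D,
          (∏ p, π (G (torusBlockSite L 2 2 x p)) (G' p)) *
            (if (∀ b : Fin 2, G' (0, b) 0 1 = G' (1, b) 0 0) ∧ (∀ a : Fin 2, G' (a, 0) 1 1 = G' (a, 1) 1 0)
              then Xf γ (fun b => G' (0, b) 0 0) (fun a => G' (a, 0) 1 0) (fun b => G' (1, b) 0 1)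
                (fun a => G' (a, 1) 1 1) else 0) := by
  rw [sum_eq_sum_offBlock_sum_block (torusBlock L 2 2 x)]
  refine Finset.sum_congr rfl fun γ _ => ?_
  simp only [prod_glue_eq (torusBlock L 2 2 x) (fun y s => t (G y) s), hXf]
  rw [← sum_block_leftInverse_pepsRect_gen L hL A t π ht x (Xf γ) G, Finset.mul_sum]
  refine Finset.sum_congr rfl fun β _ => ?_
  ring

end QLattice
end Literature.MathematicalPhysics.QuantumLattice
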